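import Literature.AlgebraicGeometry.Motives.MixedHodgeExtension
import Literature.AlgebraicGeometry.Motives.MixedHodgeStructureInternalHomFiltrations
import HarnessLib

/-!
# Separated pairs are stable under `Hom(C, −)`, `Hom(−, C)`, `− ⊗ C`, `C ⊗ −` for pure `C`

Carlson, *Extensions of mixed Hodge structures* (1980), §2(b): the theory of `Ext(A, B) ≅ J⁰Hom(A, B)`
is developed for SEPARATED pairs — the weights of `B` are at most `m` and the weights of `A` exceed `m`
(the tree's `IsSeparated A B : ∃ m, W_m B = B ∧ W_m A = 0`). Deligne, *Théorie de Hodge II*, 1.1.12: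
`W_r Hom(H₁, H₂) = {f | f(W_n H₁) ⊆ W_{n+r} H₂ ∀ n}` and `W_n(H₁ ⊗ H₂) = Σ_{i+j=n} W_i H₁ ⊗ W_j H₂`
(the tree's `mem_hom_W_iff`, `tensor_W`); so for `C` PURE of weight `w`, `Hom(C, ·)` shifts weights by
`-w`, `Hom(·, C)` reverses them around `w`, and `· ⊗ C` shifts them by `+w`.

This file proves, for a separated pair `(A, B)` and a pure `C` of weight `w` (finite-dimensional carriers):

* `IsSeparated.homLeft : IsSeparated (Hom(C, A)) (Hom(C, B))` (with `m - w`),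
  `IsSeparated.homRight : IsSeparated (Hom(B, C)) (Hom(A, C))` (with `w - m - 1`),
  `IsSeparated.rTensor : IsSeparated (A ⊗ C) (B ⊗ C)` and `IsSeparated.lTensor` (with `m + w`);
* hence the extensions `Hom(C, E)`, `Hom(E, C)`, `E ⊗ C`, `C ⊗ E` (`MixedHodgeExtensionHomFunctor`,
  `MixedHodgeExtensionTensor`) of an extension `E` of a separated pair are again extensions of separated
  pairs, so Carlson's separated theory (`Extension.cls`, `Ext.dualEquiv`, …) applies to them.

All statements proved; no named facts.

## References

* [Carlson1980] J. A. Carlson, Extensions of mixed Hodge structures (1980), §2(b).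
* [DeligneHodgeII1971] P. Deligne, Théorie de Hodge II, 1.1.12, Thm. 2.3.5.
-/

noncomputable section

open scoped TensorProduct

namespace Literature.AlgebraicGeometry.Motives

namespace MixedHodgeStructure

variable {VA : Type*} [AddCommGroup VA] [Module ℚ VA] [FiniteDimensional ℚ VA]
variable {VB : Type*} [AddCommGroup VB] [Module ℚ VB] [FiniteDimensional ℚ VB]
variable {VC : Type*} [AddCommGroup VC] [Module ℚ VC] [FiniteDimensional ℚ VC]
variable {A : MixedHodgeStructure VA} {B : MixedHodgeStructure VB} {C : MixedHodgeStructure VC} {w : ℤ}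

/-! ### `Hom(C, −)` and `Hom(−, C)` -/

/-- **`Hom(C, −)` preserves separation for pure `C` of weight `w`**: if `W_m B = B` and `W_m A = 0` then
`W_{m-w} Hom(C, B) = Hom(C, B)` and `W_{m-w} Hom(C, A) = 0` (`f ∈ W_r Hom(C, X)` iff `f(W_n C) ⊆ W_{n+r} X`
for all `n`, and `W_n C = C` for `n ≥ w`, `= 0` for `n < w`). [cite: DeligneHodgeII1971, 1.1.12] [cite: Carlson1980, §2(b)] -/
theorem IsSeparated.homLeft (hsep : IsSeparated A B) (hC : C.IsPure w) : IsSeparated (hom C A) (hom C B) := by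
  obtain ⟨m, hB, hA⟩ := hsep
  refine ⟨m - w, ?_, ?_⟩
  · refine Submodule.eq_top_iff'.2 fun f => (mem_hom_W_iff C B (m - w) f).2 fun n => ?_
    by_cases hn : n < w
    · rw [hC.1 n hn, Submodule.map_bot]
      exact bot_le
    · exact le_top.trans (hB.symm.le.trans (B.monotone_W (by omega)))
  · refine (Submodule.eq_bot_iff _).2 fun f hf => ?_
    have h := (mem_hom_W_iff C A (m - w) f).1 hf w
    rw [hC.2 w le_rfl, Submodule.map_top, show w + (m - w) = m by ring, hA, le_bot_iff,
      LinearMap.range_eq_bot] at h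
    exact h

/-- **`Hom(−, C)` reverses and preserves separation for pure `C` of weight `w`**: if `W_m B = B` and
`W_m A = 0` then `W_{w-m-1} Hom(A, C) = Hom(A, C)` and `W_{w-m-1} Hom(B, C) = 0`.
[cite: DeligneHodgeII1971, 1.1.12] [cite: Carlson1980, §2(b)] -/
theorem IsSeparated.homRight (hsep : IsSeparated A B) (hC : C.IsPure w) : IsSeparated (hom B C) (hom A C) := by
  obtain ⟨m, hB, hA⟩ := hsep
  refine ⟨w - m - 1, ?_, ?_⟩
  · refine Submodule.eq_top_iff'.2 fun f => (mem_hom_W_iff A C (w - m - 1) f).2 fun n => ?_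
    by_cases hn : n ≤ m
    · refine (Submodule.map_mono (A.monotone_W hn)).trans ?_
      rw [hA, Submodule.map_bot]
      exact bot_le
    · rw [hC.2 (n + (w - m - 1)) (by omega)]
      exact le_top
  · refine (Submodule.eq_bot_iff _).2 fun f hf => ?_
    have h := (mem_hom_W_iff B C (w - m - 1) f).1 hf m
    rw [hB, Submodule.map_top, hC.1 (m + (w - m - 1)) (by omega), le_bot_iff, LinearMap.range_eq_bot] at h
    exact h

/-! ### `− ⊗ C` and `C ⊗ −` -/

/-- **`− ⊗ C` preserves separation for pure `C` of weight `w`**: if `W_m B = B` and `W_m A = 0` then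
`W_{m+w}(B ⊗ C) ⊇ W_m B ⊗ W_w C = B ⊗ C` and `W_{m+w}(A ⊗ C) = Σ_{i+j=m+w} W_i A ⊗ W_j C = 0` (either
`i ≤ m`, so `W_i A = 0`, or `j < w`, so `W_j C = 0`). [cite: DeligneHodgeII1971, 1.1.12] [cite: Carlson1980, §2(b)] -/
theorem IsSeparated.rTensor (hsep : IsSeparated A B) (hC : C.IsPure w) : IsSeparated (tensor A C) (tensor B C) := by
  obtain ⟨m, hB, hA⟩ := hsep
  refine ⟨m + w, ?_, ?_⟩
  · refine Submodule.eq_top_iff'.2 fun z => ?_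
    have hz : z ∈ Submodule.map₂ (TensorProduct.mk ℚ VB VC) (B.W m) (C.W w) := by
      rw [hB, hC.2 w le_rfl, TensorProduct.map₂_mk_top_top_eq_top]
      exact Submodule.mem_top
    rw [tensor_W]
    exact Submodule.mem_iSup_of_mem (m, w) (Submodule.mem_iSup_of_mem rfl hz)
  · rw [tensor_W]
    refine le_bot_iff.1 (iSup₂_le fun ij (hij : ij.1 + ij.2 = m + w) => ?_)
    by_cases hi : ij.1 ≤ m
    · refine (Submodule.map₂_le_map₂_left (A.monotone_W hi)).trans ?_
      rw [hA, Submodule.map₂_bot_left]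
    · rw [hC.1 ij.2 (by omega), Submodule.map₂_bot_right]

/-- **`C ⊗ −` preserves separation for pure `C` of weight `w`** (with `m + w`).
[cite: DeligneHodgeII1971, 1.1.12] [cite: Carlson1980, §2(b)] -/
theorem IsSeparated.lTensor (hsep : IsSeparated A B) (hC : C.IsPure w) : IsSeparated (tensor C A) (tensor C B) := by
  obtain ⟨m, hB, hA⟩ := hsep
  refine ⟨m + w, ?_, ?_⟩
  · refine Submodule.eq_top_iff'.2 fun z => ?_
    have hz : z ∈ Submodule.map₂ (TensorProduct.mk ℚ VC VB) (C.W w) (B.W m) := by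
      rw [hB, hC.2 w le_rfl, TensorProduct.map₂_mk_top_top_eq_top]
      exact Submodule.mem_top
    rw [tensor_W]
    exact Submodule.mem_iSup_of_mem (w, m) (Submodule.mem_iSup_of_mem (show w + m = m + w by ring) hz)
  · rw [tensor_W]
    refine le_bot_iff.1 (iSup₂_le fun ij (hij : ij.1 + ij.2 = m + w) => ?_)
    by_cases hj : ij.2 ≤ m
    · refine (Submodule.map₂_le_map₂_right (A.monotone_W hj)).trans ?_
      rw [hA, Submodule.map₂_bot_right]
    · rw [hC.1 ij.1 (by omega), Submodule.map₂_bot_left]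

/-- The basic instance: for pure `A`, `B` of weights `a > b` and pure `C`, the pair
`(Hom(C, A), Hom(C, B))` is separated. [cite: Carlson1980, §2(b)] -/
theorem isSeparated_hom_toMixedHodgeStructure {a b : ℤ} (hab : b < a) (A' : HodgeStructure VA a)
    (B' : HodgeStructure VB b) (hC : C.IsPure w) :
    IsSeparated (hom C A'.toMixedHodgeStructure) (hom C B'.toMixedHodgeStructure) :=
  (isSeparated_toMixedHodgeStructure hab A' B').homLeft hC

end MixedHodgeStructure

end Literature.AlgebraicGeometry.Motives

end
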